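import Summits.FinalStateConjecture.FinalStateConjecture.Theorems.ZeroEnergyKerrOrBombStationaryLimitReductionKerrIsometryRigidityWave3Facts
import Summits.FinalStateConjecture.FinalStateConjecture.Theorems.ZeroEnergyKerrOrBombStationaryLimitReductionTimeEquivariantMaps
import Literature.Geometry.Lorentzian.ADMTransitionRigidity
import Literature.Geometry.Lorentzian.CoordSlice
import Literature.Geometry.Lorentzian.MultiCentreKerrSchild
import Literature.Geometry.Lorentzian.KerrWaveEnergy
import HarnessLib

/-!
# Route ZeroEnergyKerrOrBomb · crux `FinalStateFromKerrOrBomb` (stmt-FinalStateConjecture-17839), line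
# `SketchIdeator1` — stub `stub_kerrAsymptoticRigidity` (F4 of stub 1R), layer 6: the differential of the chart
# identification CONVERGES at spatial infinity, at rate `O(1/r)`, to a Lorentz transformation fixing the time axis

Helper file (`--supports stmt-FinalStateConjecture-17839`; registered helper `kerrAsymptoticRigidity_fderiv_limit`)
of the lead's wave-2 stub-worker for `stub_kerrAsymptoticRigidity : SigM.stub_kerrAsymptoticRigidity`
(`:= KerrAsymptoticRigidity`, obligation F4 of stub 1R, `…KerrIsometryRigidityWave3Facts`). Hypotheses: the binder
list of `KerrAsymptoticRigidity` VERBATIM, then the conclusion of layer 5 (`kerrAsymptoticRigidity_iteratedFDeriv_two_decay`,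
p139116: `‖D²Θ‖ ≤ C₅/r²` on `{r ≥ R₅}`). Conclusion: there is a linear map `Λ` of `E4` with `Λ e₀ = c e₀`,
`η(Λ v, Λ w) = η(v, w)`, and `‖dΘ_x − Λ‖ ≤ C₆ / r(x)` far out.

* §1 the slice function `f(y) = dΘ_{(0, y)}` on `E3` has `‖Df(y)‖ ≤ ‖D²Θ(0, y)‖ ≤ 4C₅ ‖y‖⁻²` far out
  (`r(0, y) ≥ ‖y‖/2` for `‖y‖ ≥ 2|a|`), so by the tree's radial integration on `E3` (`dim ≥ 2`,
  `TransitionRigidity.exists_limit_of_norm_fderiv_le` with `α = 1`) it has a limit `Λ` with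
  `‖f(y) − Λ‖ ≤ 4C₅ ‖y‖⁻¹`; `dΘ` is invariant under the Kerr–Schild time translation (`T`-equivariance), so
  `‖dΘ_x − Λ‖ ≤ 4C₅/‖x_{space}‖ ≤ 4C₅/r(x)`;
* §2 `Λ e₀ = c e₀` (`dΘ e₀ = c e₀` identically) and `Λ` preserves `η`: along the ray `x_t = (0, t e₁)`,
  `A.bilin(Θ x_t)(dΘ v, dΘ w) = g_{M,a}(x_t)(v, w)` with `A.bilin ∘ Θ → η` (clause (1) of
  `ChartIsAsymptoticallyCartesian`, end matching), `g_{M,a} → η` (`Kerr.exists_norm_ksPert_le`), `dΘ → Λ`;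
  uniqueness of limits.

Elementary; no named fact, nothing restated. References: R. Bartnik, CPAM 39 (1986), §3, Cor. 3.2 (existence of the
asymptotic rotation); P. T. Chruściel, *Boundary conditions at spatial infinity* (1986), §2; P. T. Chruściel,
J. L. Costa, arXiv:0806.0016, §2.1.
-/

set_option linter.dupNamespace false

-- instance search through the nested operator types `E4 →L[ℝ] E4 →L[ℝ] ℝ`
set_option maxSynthPendingDepth 3

noncomputable section

open scoped Manifold ContDiff Topology
open Set Filter Function

namespace Summit.FinalStateConjecture.FinalStateConjecture.Theorems.SymplecticDualOfTheBomb

open Literature.Geometry.Lorentzian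
open Summit.FinalStateConjecture.FinalStateConjecture.Theorems.OneLockedExplosion

/-! ## §1 Preliminaries -/

section Prelim

/-- `‖(0, y)‖ = ‖y‖`. [folklore] -/
private theorem norm_ofTimeSpace_zero (y : E3) : ‖E4.ofTimeSpace 0 y‖ = ‖y‖ := by
  have h : ‖E4.ofTimeSpace 0 y‖ ^ 2 = ‖y‖ ^ 2 := by
    rw [EuclideanSpace.real_norm_sq_eq, Fin.sum_univ_four, ← E4.spatialNorm_ofTimeSpace 0 y, E4.spatialNorm_sq]
    simp
  nlinarith [norm_nonneg (E4.ofTimeSpace 0 y), norm_nonneg y, sq_nonneg (‖E4.ofTimeSpace 0 y‖ - ‖y‖),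
    sq_nonneg (‖E4.ofTimeSpace 0 y‖ + ‖y‖)]

/-- The slice inclusion `incl : E3 →L E4` has operator norm `≤ 1`. [folklore] -/
private theorem norm_incl_le_one : ‖(CoordSlice.incl : E3 →L[ℝ] E4)‖ ≤ 1 :=
  ContinuousLinearMap.opNorm_le_bound _ zero_le_one fun y ↦ by
    rw [one_mul, CoordSlice.incl_apply, norm_ofTimeSpace_zero]

/-- `‖D²f(x)‖ = ‖D(Df)(x)‖`. [folklore] -/
private theorem norm_iteratedFDeriv_two (f : E4 → E4) (x : E4) :
    ‖iteratedFDeriv ℝ 2 f x‖ = ‖fderiv ℝ (fderiv ℝ f) x‖ :=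
  calc ‖iteratedFDeriv ℝ 2 f x‖ = ‖iteratedFDeriv ℝ 1 (fderiv ℝ f) x‖ := norm_iteratedFDeriv_fderiv.symm
    _ = ‖iteratedFDeriv ℝ 0 (fderiv ℝ (fderiv ℝ f)) x‖ := norm_iteratedFDeriv_fderiv.symm
    _ = ‖fderiv ℝ (fderiv ℝ f) x‖ := norm_iteratedFDeriv_zero

/-- `r(0, y) ≥ ‖y‖/2` for `‖y‖ ≥ 2|a|` (`r² ≥ ‖y‖² − a²`). [folklore] -/
private theorem half_norm_le_radius (a : ℝ) {y : E3} (hy : 2 * |a| ≤ ‖y‖) :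
    ‖y‖ / 2 ≤ Kerr.radius a (E4.ofTimeSpace 0 y) := by
  have h1 := Kerr.spatialNorm_sq_sub_sq_le_radius_sq a (E4.ofTimeSpace 0 y)
  rw [E4.spatialNorm_ofTimeSpace] at h1
  have ha : a ^ 2 ≤ (‖y‖ / 2) ^ 2 := by
    rw [← sq_abs a]; exact pow_le_pow_left₀ (abs_nonneg a) (by linarith) 2
  have h2 : (‖y‖ / 2) ^ 2 ≤ Kerr.radius a (E4.ofTimeSpace 0 y) ^ 2 := by nlinarith [norm_nonneg y]
  exact (pow_le_pow_iff_left₀ (by positivity) (Kerr.radius_nonneg _ _) two_ne_zero).1 h2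

variable {S : Set E4} {Θ : E4 → E4} {c : ℝ}

/-- **`dΘ` is invariant under the time translation** for a `T`-equivariant `Θ` on an open set:
`dΘ_{x + s e₀} = D(Θ(· + s e₀))(x) = D(Θ + (c s) e₀)(x) = dΘ_x`. [folklore] -/
private theorem fderiv_add_smul_eq (hSo : IsOpen S)
    (hΘT : ∀ x ∈ S, ∀ s : ℝ, Θ (x + s • E4.basisVector 0) = Θ x + (c * s) • E4.basisVector 0)
    {x : E4} (hx : x ∈ S) (s : ℝ) : fderiv ℝ Θ (x + s • E4.basisVector 0) = fderiv ℝ Θ x := by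
  rw [← fderiv_comp_add_right (s • E4.basisVector 0)]
  have h : (fun z ↦ Θ (z + s • E4.basisVector 0)) =ᶠ[𝓝 x] fun z ↦ Θ z + (c * s) • E4.basisVector 0 :=
    Filter.eventuallyEq_of_mem (hSo.mem_nhds hx) fun z hz ↦ hΘT z hz s
  rw [h.fderiv_eq, fderiv_add_const]

/-- Joint continuity of evaluation: `c_t → c₀`, `u_t → u₀` imply `c_t u_t → c₀ u₀`. [folklore] -/
private theorem tendsto_clm_apply {α : Type*} {l : Filter α} {F : Type*} [NormedAddCommGroup F] [NormedSpace ℝ F]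
    {κ : α → E4 →L[ℝ] F} {κ₀ : E4 →L[ℝ] F} {u : α → E4} {u₀ : E4}
    (hκ : Tendsto κ l (𝓝 κ₀)) (hu : Tendsto u l (𝓝 u₀)) : Tendsto (fun t ↦ κ t (u t)) l (𝓝 (κ₀ u₀)) :=
  ((isBoundedBilinearMap_apply (𝕜 := ℝ) (E := E4) (F := F)).continuous.tendsto (κ₀, u₀)).comp
    (hκ.prodMk_nhds hu)

/-- A function eventually within `C/ρ_t` of `L`, with `ρ_t → ∞`, tends to `L`. [folklore] -/
private theorem tendsto_of_norm_sub_le_div {α : Type*} {l : Filter α} {F : Type*} [NormedAddCommGroup F]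
    {g : α → F} {L : F} {ρ : α → ℝ} {C : ℝ} (hρ : Tendsto ρ l atTop)
    (h : ∀ᶠ t in l, ‖g t - L‖ ≤ C / ρ t) : Tendsto g l (𝓝 L) := by
  rw [tendsto_iff_norm_sub_tendsto_zero]
  have hC : Tendsto (fun t ↦ C / ρ t) l (𝓝 0) := hρ.const_div_atTop C
  exact squeeze_zero' (Eventually.of_forall fun t ↦ norm_nonneg _) h hC

end Prelim

/-! ## §2 The limit of `dΘ` at spatial infinity -/

/-- **Registered helper `kerrAsymptoticRigidity_fderiv_limit`** (layer 6 of F4 = `KerrAsymptoticRigidity`; its binder list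
verbatim, followed by the conclusion of layer 5, `‖D²Θ‖ ≤ C₅/r²` far out): there is a linear map `Λ` of `E4` with
`Λ e₀ = c e₀`, `η(Λ v, Λ w) = η(v, w)` for all `v, w`, and `‖dΘ_x − Λ‖ ≤ C₆ / r(x)` far out along the exterior.
The slice function `y ↦ dΘ_{(0,y)}` on `E3` has derivative `O(‖y‖⁻²)`, hence (radial integration in dimension
`3 ≥ 2`, `TransitionRigidity.exists_limit_of_norm_fderiv_le`, `α = 1`) a limit `Λ` at rate `O(‖y‖⁻¹)`; `dΘ` is
time-translation invariant. Along the ray `(0, t e₁)` the isometry clause `A.bilin(Θ x)(dΘ v, dΘ w) = g_{M,a}(x)(v, w)`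
passes to the limit (`A.bilin ∘ Θ → η`, `g_{M,a} → η`, `dΘ → Λ`), and `dΘ e₀ = c e₀` identically. Bartnik 1986, §3,
Cor. 3.2; Chruściel 1986, §2; Chruściel–Costa arXiv:0806.0016, §2.1. [folklore] -/
theorem kerrAsymptoticRigidity_fderiv_limit : ∀ (𝓑 : StationaryAFBlackHole.{0}) (A : 𝓑.AdaptedChart) (M a c : ℝ) (Θ : E4 → E4), ChartIsAsymptoticallyCartesian A → ChartIsAsymptoticallySchwarzschildean' A → Kerr.IsSubextremal M a → 0 < c → ContDiffOn ℝ ∞ Θ (Kerr.exterior M a : Set E4) → Set.InjOn Θ (Kerr.exterior M a : Set E4) → Set.MapsTo Θ (Kerr.exterior M a : Set E4) (A.domain : Set E4) → (∀ x ∈ (Kerr.exterior M a : Set E4), ∀ s : ℝ, Θ (x + s • E4.basisVector 0) = Θ x + (c * s) • E4.basisVector 0) → (∀ x ∈ (Kerr.exterior M a : Set E4), ∀ v w : E4, A.bilin (Θ x) (fderiv ℝ Θ x v) (fderiv ℝ Θ x w) = Kerr.bilin M a x v w) → Θ '' (Kerr.exterior M a : Set E4) = {u : E4 | ∃ h : u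 ∈ A.domain, A.toFun ⟨u, h⟩ ∈ 𝓑.doc} → (∀ R₁ : ℝ, ∃ R : ℝ, ∀ x ∈ (Kerr.exterior M a : Set E4), R ≤ Kerr.radius a x → R₁ ≤ A.radius (Θ x)) → (∃ R₅ C₅ : ℝ, ∀ u ∈ (Kerr.exterior M a : Set E4), R₅ ≤ Kerr.radius a u → ‖iteratedFDeriv ℝ 2 Θ u‖ ≤ C₅ / Kerr.radius a u ^ 2) → ∃ Λ : E4 →L[ℝ] E4, Λ (E4.basisVector 0) = c • E4.basisVector 0 ∧ (∀ v w : E4, Minkowski.bilin (Λ v) (Λ w) = Minkowski.bilin v w) ∧ ∃ R₆ C₆ : ℝ, ∀ x ∈ (Kerr.exterior M a : Set E4), R₆ ≤ Kerr.radius a x → ‖fderiv ℝ Θ x - Λ‖ ≤ C₆ / Kerr.radius a x := by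
  intro 𝓑 A M a c Θ hcart _ _ _ hΘs _ hΘmaps hΘT hΘiso _ hfar h5
  obtain ⟨R₅, C₅, h5⟩ := h5
  set S : Set E4 := (Kerr.exterior M a : Set E4) with hS_def
  have hSo : IsOpen S := (Kerr.exterior M a).isOpen
  /- §1 the slice function and its limit -/
  set f : E3 → E4 →L[ℝ] E4 := fun y ↦ fderiv ℝ Θ (E4.ofTimeSpace 0 y) with hf_def
  set Q : ℝ := max (max R₅ (max (Kerr.rPlus M a) 0 + 1)) |a| with hQ_def
  have hQ0 : 0 < Q := lt_of_lt_of_le (by positivity) ((le_max_right _ _).trans (le_max_left _ _))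
  set R' : ℝ := 2 * Q with hR'_def
  have hR'0 : 0 < R' := by positivity
  have hfar' : ∀ y : E3, R' ≤ ‖y‖ → E4.ofTimeSpace 0 y ∈ S ∧ R₅ ≤ Kerr.radius a (E4.ofTimeSpace 0 y) ∧
      ‖y‖ / 2 ≤ Kerr.radius a (E4.ofTimeSpace 0 y) := by
    intro y hy
    have ha : 2 * |a| ≤ ‖y‖ := le_trans (by linarith [le_max_right (max R₅ (max (Kerr.rPlus M a) 0 + 1)) |a|]) hy
    have hhalf := half_norm_le_radius a ha
    have hQr : Q ≤ Kerr.radius a (E4.ofTimeSpace 0 y) := le_trans (by linarith) hhalf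
    refine ⟨?_, ((le_max_left _ _).trans (le_max_left _ _)).trans hQr, hhalf⟩
    rw [hS_def, SetLike.mem_coe, Kerr.mem_exterior]
    have : max (Kerr.rPlus M a) 0 + 1 ≤ Q := (le_max_right _ _).trans (le_max_left _ _)
    linarith
  have hfd : ∀ y : E3, R' ≤ ‖y‖ →
      HasFDerivAt f ((fderiv ℝ (fderiv ℝ Θ) (E4.ofTimeSpace 0 y)).comp CoordSlice.incl) y := by
    intro y hy
    obtain ⟨hyS, -, -⟩ := hfar' y hy
    have hΘy : ContDiffAt ℝ ∞ Θ (E4.ofTimeSpace 0 y) := hΘs.contDiffAt (hSo.mem_nhds hyS)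
    have h1 : ContDiffAt ℝ 1 (fderiv ℝ Θ) (E4.ofTimeSpace 0 y) :=
      hΘy.fderiv_right (m := 1) (WithTop.coe_le_coe.mpr le_top)
    exact (h1.differentiableAt one_ne_zero).hasFDerivAt.comp y (CoordSlice.hasFDerivAt_ofTimeSpace_zero y)
  have hbound : ∀ y : E3, R' ≤ ‖y‖ → ‖fderiv ℝ f y‖ ≤ (4 * |C₅|) * ‖y‖ ^ (-1 - 1 : ℝ) := by
    intro y hy
    obtain ⟨hyS, hR5, hhalf⟩ := hfar' y hy
    have hy0 : 0 < ‖y‖ := hR'0.trans_le hy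
    have hr0 : 0 < Kerr.radius a (E4.ofTimeSpace 0 y) := by linarith
    rw [(hfd y hy).fderiv, show (-1 - 1 : ℝ) = -(2 : ℝ) by norm_num, Real.rpow_neg hy0.le, Real.rpow_two]
    calc ‖(fderiv ℝ (fderiv ℝ Θ) (E4.ofTimeSpace 0 y)).comp CoordSlice.incl‖
        ≤ ‖fderiv ℝ (fderiv ℝ Θ) (E4.ofTimeSpace 0 y)‖ * ‖(CoordSlice.incl : E3 →L[ℝ] E4)‖ :=
          ContinuousLinearMap.opNorm_comp_le _ _
      _ ≤ ‖fderiv ℝ (fderiv ℝ Θ) (E4.ofTimeSpace 0 y)‖ * 1 := by gcongr; exact norm_incl_le_one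
      _ = ‖iteratedFDeriv ℝ 2 Θ (E4.ofTimeSpace 0 y)‖ := by rw [mul_one, norm_iteratedFDeriv_two]
      _ ≤ C₅ / Kerr.radius a (E4.ofTimeSpace 0 y) ^ 2 := h5 _ hyS hR5
      _ ≤ |C₅| / Kerr.radius a (E4.ofTimeSpace 0 y) ^ 2 := by gcongr; exact le_abs_self _
      _ ≤ |C₅| / (‖y‖ / 2) ^ 2 := by
          apply div_le_div_of_nonneg_left (abs_nonneg _) (by positivity)
          exact pow_le_pow_left₀ (by positivity) hhalf 2
      _ = 4 * |C₅| * (‖y‖ ^ 2)⁻¹ := by field_simp; ring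
  have h2 : 2 ≤ Module.finrank ℝ E3 := by
    rw [finrank_euclideanSpace_fin]; norm_num
  obtain ⟨Λ, hΛ⟩ := TransitionRigidity.exists_limit_of_norm_fderiv_le (F := E4 →L[ℝ] E4) h2 hR'0 one_pos
    (by positivity) (fun z hz ↦ (hfd z hz).differentiableAt) hbound
  /- transfer to `E4` by time-translation invariance of `dΘ` -/
  have hrate : ∀ x ∈ S, 2 * R' ≤ Kerr.radius a x → ‖fderiv ℝ Θ x - Λ‖ ≤ 4 * |C₅| / Kerr.radius a x := by
    intro x hx hxR
    have hr0 : 0 < Kerr.radius a x := Kerr.radius_pos_of_mem_region hx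
    have hsp : 2 * R' ≤ ‖E4.spatial x‖ := hxR.trans (Kerr.radius_le_spatialNorm a x)
    have e : fderiv ℝ Θ x = f (E4.spatial x) := by
      have hx' : E4.ofTimeSpace 0 (E4.spatial x) ∈ S := (hfar' _ (by linarith)).1
      conv_lhs => rw [← ofTimeSpace_zero_spatial_add_time_smul x]
      exact fderiv_add_smul_eq hSo hΘT hx' _
    rw [e]
    refine (hΛ _ hsp).trans ?_
    rw [div_one, Real.rpow_neg_one, ← div_eq_mul_inv]
    exact div_le_div_of_nonneg_left (by positivity) hr0 (Kerr.radius_le_spatialNorm a x)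
  /- §2 the ray `x_t = (0, t e₁)` -/
  set e₁ : E3 := EuclideanSpace.single 0 1 with he₁
  set xt : ℝ → E4 := fun t ↦ E4.ofTimeSpace 0 (t • e₁) with hxt
  have hnt : ∀ t : ℝ, ‖t • e₁‖ = |t| := fun t ↦ by
    rw [norm_smul, he₁, PiLp.norm_single, norm_one, mul_one, Real.norm_eq_abs]
  have hr_t : Tendsto (fun t ↦ Kerr.radius a (xt t)) atTop atTop := by
    refine tendsto_atTop_mono' atTop ?_ (tendsto_id.atTop_div_const (by norm_num : (0 : ℝ) < 2))
    filter_upwards [eventually_ge_atTop (2 * |a|), eventually_ge_atTop (0 : ℝ)] with t ht ht0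
    have h := half_norm_le_radius a (y := t • e₁) (by rw [hnt, abs_of_nonneg ht0]; exact ht)
    rw [hnt, abs_of_nonneg ht0] at h
    exact h
  have hS_t : ∀ᶠ t in atTop, xt t ∈ S ∧ 2 * R' ≤ Kerr.radius a (xt t) := by
    filter_upwards [hr_t.eventually_ge_atTop (max (2 * R') (max (Kerr.rPlus M a) 0 + 1))] with t ht
    refine ⟨?_, (le_max_left _ _).trans ht⟩
    rw [hS_def, SetLike.mem_coe, Kerr.mem_exterior]
    linarith [le_max_right (2 * R') (max (Kerr.rPlus M a) 0 + 1)]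
  -- `dΘ(x_t) → Λ`
  have hP : Tendsto (fun t ↦ fderiv ℝ Θ (xt t)) atTop (𝓝 Λ) :=
    tendsto_of_norm_sub_le_div hr_t (hS_t.mono fun t ht ↦ hrate _ ht.1 ht.2)
  -- `g_{M,a}(x_t) → η`
  obtain ⟨CK, RK, -, hK⟩ := Kerr.exists_norm_ksPert_le M a
  have hBK : Tendsto (fun t ↦ Kerr.bilin M a (xt t)) atTop (𝓝 Minkowski.bilin) :=
    tendsto_of_norm_sub_le_div hr_t ((hr_t.eventually_ge_atTop RK).mono fun t ht ↦ hK _ ht)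
  -- `A.bilin (Θ x_t) → η`
  have hBA : Tendsto (fun t ↦ A.bilin (Θ (xt t))) atTop (𝓝 Minkowski.bilin) := by
    rw [tendsto_iff_norm_sub_tendsto_zero]
    refine Metric.tendsto_atTop.2 fun ε hε ↦ ?_
    obtain ⟨R₀, hR₀⟩ := hcart.1 (ε / 2) (half_pos hε)
    obtain ⟨R₁, hR₁⟩ := hfar R₀
    obtain ⟨N, hN⟩ := Filter.eventually_atTop.1 (hS_t.and (hr_t.eventually_ge_atTop R₁))
    refine ⟨N, fun t ht ↦ ?_⟩
    obtain ⟨⟨htS, -⟩, htR⟩ := hN t ht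
    rw [dist_zero_right, norm_norm]
    have := hR₀ ⟨Θ (xt t), hΘmaps htS⟩ (hR₁ _ htS htR)
    linarith
  -- `Λ e₀ = c e₀`
  have hΛ0 : Λ (E4.basisVector 0) = c • E4.basisVector 0 := by
    have h1 : Tendsto (fun t ↦ fderiv ℝ Θ (xt t) (E4.basisVector 0)) atTop (𝓝 (Λ (E4.basisVector 0))) :=
      tendsto_clm_apply hP tendsto_const_nhds
    have h3 : ∀ᶠ t in atTop, c • E4.basisVector 0 = fderiv ℝ Θ (xt t) (E4.basisVector 0) :=
      hS_t.mono fun t ht ↦ (fderiv_apply_basisVector_zero_of_contDiffOn hSo (by simp) hΘs hΘT ht.1).symm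
    exact tendsto_nhds_unique h1 (tendsto_const_nhds.congr' h3)
  -- `Λ` preserves `η`
  have hΛη : ∀ v w : E4, Minkowski.bilin (Λ v) (Λ w) = Minkowski.bilin v w := by
    intro v w
    have hv : Tendsto (fun t ↦ fderiv ℝ Θ (xt t) v) atTop (𝓝 (Λ v)) := tendsto_clm_apply hP tendsto_const_nhds
    have hw : Tendsto (fun t ↦ fderiv ℝ Θ (xt t) w) atTop (𝓝 (Λ w)) := tendsto_clm_apply hP tendsto_const_nhds
    have h1 : Tendsto (fun t ↦ A.bilin (Θ (xt t)) (fderiv ℝ Θ (xt t) v) (fderiv ℝ Θ (xt t) w)) atTop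
        (𝓝 (Minkowski.bilin (Λ v) (Λ w))) :=
      tendsto_clm_apply (tendsto_clm_apply hBA hv) hw
    have h2' : Tendsto (fun t ↦ Kerr.bilin M a (xt t) v w) atTop (𝓝 (Minkowski.bilin v w)) :=
      tendsto_clm_apply (tendsto_clm_apply hBK tendsto_const_nhds) tendsto_const_nhds
    have h3 : ∀ᶠ t in atTop,
        Kerr.bilin M a (xt t) v w = A.bilin (Θ (xt t)) (fderiv ℝ Θ (xt t) v) (fderiv ℝ Θ (xt t) w) :=
      hS_t.mono fun t ht ↦ (hΘiso _ ht.1 v w).symm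
    exact tendsto_nhds_unique h1 (h2'.congr' h3)
  exact ⟨Λ, hΛ0, hΛη, 2 * R', 4 * |C₅|, hrate⟩

end Summit.FinalStateConjecture.FinalStateConjecture.Theorems.SymplecticDualOfTheBomb

end
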